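import Literature.AnabelianGeometry.SemiGraphs.PSCSeparatingCoveringsTwoNodeCycleEdges
import Literature.AnabelianGeometry.SemiGraphs.PSCUnrVerticialSeparatingCoveringsTwoNodeCycle
import Literature.AnabelianGeometry.SemiGraphs.PSCTwoNodeCycleDatum
import HarnessLib

/-!
# [CombGC] Prop. 1.2 IN FULL at the TWO-NODE-CYCLE shape, with an inhabited sturdy origin (rows F-2829/F-2830, F-0438, F-0459)

Mochizuki, *A combinatorial version of the Grothendieck conjecture*, Tohoku Math. J. **59** (2007)
[CombGC], Prop. 1.2 pp. 8–9 [cite: MochizukiCombGC2007, Prop 1.2 pp.8-9].  PROOF-ONLY assembly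
(abc-iut-f-164 gen 5, NEXT-SHAPES row «TWO-NODE-CYCLE») of the three separating-coverings conjuncts at
the data of two-node-cycle shape — two components `v₀` (genus `m ≥ 1`, cusps `c_s,…,c_{r-1}`) and `v₁`
(genus `g-m-1 ≥ 1`, cusps `c_0,…,c_{s-1}`, `1 ≤ s ≤ r-1`) joined by TWO nodes `⟨b_m⟩`, `⟨δ⟩`, the first
dual graph with a CYCLE: F-2826 (`PSCSeparatingCoveringsTwoNodeCycle`), F-2827 (`…Edges`), F-2828
(`PSCUnrVerticialSeparatingCoveringsTwoNodeCycle`, via `Γ/⟨⟨b_m,δ,c_j⟩⟩ ≅ Γ_{m,0} ∗ (ℤ ∗ Γ_{g-m-1,0})`).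

* `separatingCoverings_of_twoNodeCycle` — **F-2829, hypothesis-free**, at every such datum;
* `prop12_of_twoNodeCycle` — **[CombGC] Prop. 1.2 (i) (all three cases) and (ii) (both clauses)** there
  (w5-d183's `prop12_of_separating`);
* `exists_twoNodeCycleOrigin_prop12_holds` — the origin of these data satisfies `SeparatingCoveringsHolds`
  (F-2830), `CommensurableTerminalityHolds` (F-0438) and `OpenInterDeterminesComponentHolds` (F-0459) and is
  INHABITED by a STURDY datum, "two once-punctured genus-2 curves glued at two points" (`Γ_{5,2}`,
  `i = n = r = 2`; `exists_twoNodeCycleDatum`);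
* `exists_twoNodeCycleOrigin_thm16i_holds` — with `Σ = {l}`: additionally F-1931
  (`CuspidalEdgeLikeCharacterizationHolds`) and **F-0458 / Thm. 1.6 (i)** (`NumericallyCuspidalIffHolds`).
Instances at data of the shape of genuine curves; consistency evidence for the typed rows, not the
printed theorems for all pointed stable curves.  Nothing here takes a side on [IUTchIII] Cor. 3.12.
-/

noncomputable section

namespace Literature.AnabelianGeometry.SemiGraphs

open scoped Pointwise
open Literature.GroupTheory.CombinatorialGroupTheory
open SemiGraphOfAnabelioids (IsProSigmaCompletion)

namespace PSCDatum

section Shape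

variable {P : Type} [Group P] [TopologicalSpace P] [IsTopologicalGroup P]
variable [CompactSpace P] [TotallyDisconnectedSpace P] {Sigma : Set ℕ} {g r : ℕ}

/-- **F-2829 (`SeparatingCoverings`, all three conjuncts), hypothesis-free, at EVERY two-node-cycle
datum** (`m ≥ 1`, `g - m - 1 ≥ 1`, `1 ≤ s ≤ r - 1`, two distinct nodes).
[cite: MochizukiCombGC2007, Prop 1.2 proof p.9] -/
theorem separatingCoverings_of_twoNodeCycle (hne : Sigma.Nonempty)
    (hprime : ∀ p ∈ Sigma, p.Prime) (ι : PuncturedSurfaceGroup g r →* P)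
    (hι : IsProSigmaCompletion Sigma ι) (G : PSCDatum P) {m s : ℕ} (hm : m + 2 ≤ g) (hm1 : 1 ≤ m)
    (hs1 : 1 ≤ s) (hsr : s + 1 ≤ r)
    (e : G.graph.C ≃ Fin r)
    (hC : ∀ c', G.cuspGp c' = ((PuncturedSurfaceGroup.cuspInertia (g := g) (e c')).map ι).topologicalClosure)
    (v₀ v₁ : G.graph.V) (hV : ∀ w, w = v₀ ∨ w = v₁)
    (n₁ n₂ : G.graph.N) (hn : n₁ ≠ n₂) (hN : ∀ n, n = n₁ ∨ n = n₂) (δ : PuncturedSurfaceGroup g r)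
    (hδ : δ = (((List.finRange r).map fun j : Fin r =>
        if (j : ℕ) < s then PuncturedSurfaceGroup.c (g := g) j else 1).prod)⁻¹ *
      (((List.finRange g).map fun i : Fin g => if m + 1 ≤ (i : ℕ) then
        PuncturedSurfaceGroup.a (r := r) i * PuncturedSurfaceGroup.b i *
          (PuncturedSurfaceGroup.a i)⁻¹ * (PuncturedSurfaceGroup.b i)⁻¹ else 1).prod)⁻¹ *
      PuncturedSurfaceGroup.b ⟨m, by omega⟩)
    (hV₀ : G.vertGp v₀ = ((Subgroup.closure {x : PuncturedSurfaceGroup g r |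
        (∃ i : Fin g, (i : ℕ) < m ∧ (x = PuncturedSurfaceGroup.a i ∨ x = PuncturedSurfaceGroup.b i)) ∨
        (∃ j : Fin r, s ≤ (j : ℕ) ∧ x = PuncturedSurfaceGroup.c j) ∨
        x = PuncturedSurfaceGroup.a ⟨m, by omega⟩ * PuncturedSurfaceGroup.b ⟨m, by omega⟩ *
          (PuncturedSurfaceGroup.a ⟨m, by omega⟩)⁻¹ ∨ x = δ}).map ι).topologicalClosure)
    (hV₁ : G.vertGp v₁ = ((Subgroup.closure {x : PuncturedSurfaceGroup g r |
        (∃ i : Fin g, m < (i : ℕ) ∧ (x = PuncturedSurfaceGroup.a i ∨ x = PuncturedSurfaceGroup.b i)) ∨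
        (∃ j : Fin r, (j : ℕ) < s ∧ x = PuncturedSurfaceGroup.c j) ∨
        x = PuncturedSurfaceGroup.b ⟨m, by omega⟩ ∨ x = δ}).map ι).topologicalClosure)
    (hE₁ : G.nodeGp n₁ = ((Subgroup.zpowers (PuncturedSurfaceGroup.b (r := r) ⟨m, by omega⟩)).map
      ι).topologicalClosure)
    (hE₂ : G.nodeGp n₂ = ((Subgroup.zpowers δ).map ι).topologicalClosure) :
    G.SeparatingCoverings :=
  ⟨G.verticialSeparatingCoverings_of_twoNodeCycle hne hprime ι hι hm hm1 hs1 hsr v₀ v₁ hV δ hδ hV₀ hV₁,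
    G.edgeLikeSeparatingCoverings_of_twoNodeCycle hne hprime ι hι hm hs1 hsr e hC n₁ n₂ hN δ hδ hE₁ hE₂,
    G.unrVerticialSeparatingCoverings_of_twoNodeCycle hne hprime ι hι hm hm1 e hC v₀ v₁ hV n₁ n₂ hn hN δ hδ
      hV₀ hV₁ hE₁ hE₂⟩

/-- **[CombGC] Prop. 1.2 (i) (all three cases: F-0459) and (ii) (both clauses: F-0438), hypothesis-free,
at EVERY two-node-cycle datum** — the first dual graph with a cycle: w5-d183's `prop12_of_separating`
on F-2829 above. [cite: MochizukiCombGC2007, Prop 1.2 pp.8-9] -/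
theorem prop12_of_twoNodeCycle (hne : Sigma.Nonempty)
    (hprime : ∀ p ∈ Sigma, p.Prime) (ι : PuncturedSurfaceGroup g r →* P)
    (hι : IsProSigmaCompletion Sigma ι) (G : PSCDatum P) {m s : ℕ} (hm : m + 2 ≤ g) (hm1 : 1 ≤ m)
    (hs1 : 1 ≤ s) (hsr : s + 1 ≤ r)
    (e : G.graph.C ≃ Fin r)
    (hC : ∀ c', G.cuspGp c' = ((PuncturedSurfaceGroup.cuspInertia (g := g) (e c')).map ι).topologicalClosure)
    (v₀ v₁ : G.graph.V) (hV : ∀ w, w = v₀ ∨ w = v₁)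
    (n₁ n₂ : G.graph.N) (hn : n₁ ≠ n₂) (hN : ∀ n, n = n₁ ∨ n = n₂) (δ : PuncturedSurfaceGroup g r)
    (hδ : δ = (((List.finRange r).map fun j : Fin r =>
        if (j : ℕ) < s then PuncturedSurfaceGroup.c (g := g) j else 1).prod)⁻¹ *
      (((List.finRange g).map fun i : Fin g => if m + 1 ≤ (i : ℕ) then
        PuncturedSurfaceGroup.a (r := r) i * PuncturedSurfaceGroup.b i *
          (PuncturedSurfaceGroup.a i)⁻¹ * (PuncturedSurfaceGroup.b i)⁻¹ else 1).prod)⁻¹ *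
      PuncturedSurfaceGroup.b ⟨m, by omega⟩)
    (hV₀ : G.vertGp v₀ = ((Subgroup.closure {x : PuncturedSurfaceGroup g r |
        (∃ i : Fin g, (i : ℕ) < m ∧ (x = PuncturedSurfaceGroup.a i ∨ x = PuncturedSurfaceGroup.b i)) ∨
        (∃ j : Fin r, s ≤ (j : ℕ) ∧ x = PuncturedSurfaceGroup.c j) ∨
        x = PuncturedSurfaceGroup.a ⟨m, by omega⟩ * PuncturedSurfaceGroup.b ⟨m, by omega⟩ *
          (PuncturedSurfaceGroup.a ⟨m, by omega⟩)⁻¹ ∨ x = δ}).map ι).topologicalClosure)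
    (hV₁ : G.vertGp v₁ = ((Subgroup.closure {x : PuncturedSurfaceGroup g r |
        (∃ i : Fin g, m < (i : ℕ) ∧ (x = PuncturedSurfaceGroup.a i ∨ x = PuncturedSurfaceGroup.b i)) ∨
        (∃ j : Fin r, (j : ℕ) < s ∧ x = PuncturedSurfaceGroup.c j) ∨
        x = PuncturedSurfaceGroup.b ⟨m, by omega⟩ ∨ x = δ}).map ι).topologicalClosure)
    (hE₁ : G.nodeGp n₁ = ((Subgroup.zpowers (PuncturedSurfaceGroup.b (r := r) ⟨m, by omega⟩)).map
      ι).topologicalClosure)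
    (hE₂ : G.nodeGp n₂ = ((Subgroup.zpowers δ).map ι).topologicalClosure) :
    (G.VerticialOpenInterDeterminesVertex ∧ G.EdgeLikeOpenInterDeterminesEdge ∧
      G.UnrVerticialOpenInterDeterminesVertex) ∧
    (G.VerticialEdgeLikeCommensurablyTerminal ∧ G.UnrVerticialCommensurablyTerminal) :=
  G.prop12_of_separating (G.separatingCoverings_of_twoNodeCycle hne hprime ι hι hm hm1 hs1 hsr e hC v₀ v₁ hV
    n₁ n₂ hn hN δ hδ hV₀ hV₁ hE₁ hE₂)

end Shape

/-! ### The origin of two-node-cycle data -/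

/-- Two listed nodes of a semi-graph with `n = 2` nodes are distinct. [cite: MochizukiCombGC2007, Def 1.1(i) p.6] -/
theorem nodes_ne_of_n_eq_two {Q : Type*} [Group Q] [TopologicalSpace Q] (G : PSCDatum Q)
    (n₁ n₂ : G.graph.N) (hN : ∀ n, n = n₁ ∨ n = n₂) (hn : G.graph.n = 2) : n₁ ≠ n₂ := by
  intro h
  have hall : ∀ n, n = n₁ := fun n => (hN n).elim id fun h' => h'.trans h.symm
  have hle : Fintype.card G.graph.N ≤ 1 := Fintype.card_le_one_iff.mpr fun x y => (hall x).trans (hall y).symm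
  change Fintype.card G.graph.N = 2 at hn
  omega

/-- **Rows F-2829/F-2830, F-0438 (both clauses) and F-0459 at the origin of ALL two-node-cycle data**
(`m ≥ 1`, `g - m - 1 ≥ 1`, `1 ≤ s ≤ r - 1`), hypothesis-free, inhabited by the STURDY datum "two
once-punctured genus-`2` curves glued at two points" (`Γ_{5,2}`, `i = n = r = 2`) — the first dual graph
with a cycle at which [CombGC] Prop. 1.2 is settled in full. [cite: MochizukiCombGC2007, Prop 1.2 pp.8-9] -/
theorem exists_twoNodeCycleOrigin_prop12_holds (Sigma : Set ℕ) (hne : Sigma.Nonempty)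
    (hprime : ∀ p ∈ Sigma, p.Prime) :
    ∃ Ω : PSCOrigin.{0},
      (∃ (Q : ProfiniteGrp.{0}) (G : PSCDatum Q), Ω.IsOfPSCType G ∧ G.IsSturdy ∧ G.Sigma = Sigma ∧
        G.graph.i = 2 ∧ G.graph.n = 2 ∧ G.graph.r = 2) ∧
      SeparatingCoveringsHolds Ω ∧ CommensurableTerminalityHolds Ω ∧ OpenInterDeterminesComponentHolds Ω := by
  classical
  let Ω : PSCOrigin.{0} :=
    ⟨fun {Q} _ _ G => ∃ (_ : IsTopologicalGroup Q), CompactSpace Q ∧ T2Space Q ∧ TotallyDisconnectedSpace Q ∧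
      ∃ (S : Set ℕ) (g r m s : ℕ) (hm : m + 2 ≤ g) (ι : PuncturedSurfaceGroup g r →* Q)
        (e : G.graph.C ≃ Fin r) (v₀ v₁ : G.graph.V) (n₁ n₂ : G.graph.N),
        S.Nonempty ∧ (∀ p ∈ S, p.Prime) ∧ IsProSigmaCompletion S ι ∧ 1 ≤ m ∧ 1 ≤ s ∧ s + 1 ≤ r ∧
        (∀ c, G.cuspGp c =
          ((PuncturedSurfaceGroup.cuspInertia (g := g) (e c)).map ι).topologicalClosure) ∧
        (∀ w, w = v₀ ∨ w = v₁) ∧ n₁ ≠ n₂ ∧ (∀ n, n = n₁ ∨ n = n₂) ∧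
        G.vertGp v₀ = ((Subgroup.closure {x : PuncturedSurfaceGroup g r |
          (∃ i : Fin g, (i : ℕ) < m ∧ (x = PuncturedSurfaceGroup.a i ∨ x = PuncturedSurfaceGroup.b i)) ∨
          (∃ j : Fin r, s ≤ (j : ℕ) ∧ x = PuncturedSurfaceGroup.c j) ∨
          x = PuncturedSurfaceGroup.a ⟨m, by omega⟩ * PuncturedSurfaceGroup.b ⟨m, by omega⟩ *
            (PuncturedSurfaceGroup.a ⟨m, by omega⟩)⁻¹ ∨
          x = (((List.finRange r).map fun j : Fin r =>
              if (j : ℕ) < s then PuncturedSurfaceGroup.c (g := g) j else 1).prod)⁻¹ *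
            (((List.finRange g).map fun i : Fin g => if m + 1 ≤ (i : ℕ) then
              PuncturedSurfaceGroup.a (r := r) i * PuncturedSurfaceGroup.b i *
                (PuncturedSurfaceGroup.a i)⁻¹ * (PuncturedSurfaceGroup.b i)⁻¹ else 1).prod)⁻¹ *
            PuncturedSurfaceGroup.b ⟨m, by omega⟩}).map ι).topologicalClosure ∧
        G.vertGp v₁ = ((Subgroup.closure {x : PuncturedSurfaceGroup g r |
          (∃ i : Fin g, m < (i : ℕ) ∧ (x = PuncturedSurfaceGroup.a i ∨ x = PuncturedSurfaceGroup.b i)) ∨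
          (∃ j : Fin r, (j : ℕ) < s ∧ x = PuncturedSurfaceGroup.c j) ∨
          x = PuncturedSurfaceGroup.b ⟨m, by omega⟩ ∨
          x = (((List.finRange r).map fun j : Fin r =>
              if (j : ℕ) < s then PuncturedSurfaceGroup.c (g := g) j else 1).prod)⁻¹ *
            (((List.finRange g).map fun i : Fin g => if m + 1 ≤ (i : ℕ) then
              PuncturedSurfaceGroup.a (r := r) i * PuncturedSurfaceGroup.b i *
                (PuncturedSurfaceGroup.a i)⁻¹ * (PuncturedSurfaceGroup.b i)⁻¹ else 1).prod)⁻¹ *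
            PuncturedSurfaceGroup.b ⟨m, by omega⟩}).map ι).topologicalClosure ∧
        G.nodeGp n₁ = ((Subgroup.zpowers (PuncturedSurfaceGroup.b (r := r) ⟨m, by omega⟩)).map
          ι).topologicalClosure ∧
        G.nodeGp n₂ = ((Subgroup.zpowers ((((List.finRange r).map fun j : Fin r =>
              if (j : ℕ) < s then PuncturedSurfaceGroup.c (g := g) j else 1).prod)⁻¹ *
            (((List.finRange g).map fun i : Fin g => if m + 1 ≤ (i : ℕ) then
              PuncturedSurfaceGroup.a (r := r) i * PuncturedSurfaceGroup.b i *
                (PuncturedSurfaceGroup.a i)⁻¹ * (PuncturedSurfaceGroup.b i)⁻¹ else 1).prod)⁻¹ *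
            PuncturedSurfaceGroup.b ⟨m, by omega⟩)).map ι).topologicalClosure⟩
  have hsep : SeparatingCoveringsHolds Ω := by
    intro Q _ _ _ G hG
    obtain ⟨_, hc, ht, hd, S, g, r, m, s, hm, ι, e, v₀, v₁, n₁, n₂, hSne, hSp, hι, hm1, hs1, hsr, hC, hV, hn,
      hN, hV₀, hV₁, hE₁, hE₂⟩ := hG
    haveI := hc
    haveI := hd
    exact G.separatingCoverings_of_twoNodeCycle hSne hSp ι hι hm hm1 hs1 hsr e hC v₀ v₁ hV n₁ n₂ hn hN _ rfl
      hV₀ hV₁ hE₁ hE₂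
  have hprof : ∀ ⦃Q : Type⦄ [Group Q] [TopologicalSpace Q] [IsTopologicalGroup Q] (G : PSCDatum Q),
      Ω.IsOfPSCType G → CompactSpace Q ∧ TotallyDisconnectedSpace Q := fun Q _ _ _ G hG => by
    obtain ⟨_, hc, -, hd, -⟩ := hG
    exact ⟨hc, hd⟩
  refine ⟨Ω, ?_, hsep, commensurableTerminalityHolds_of_separating Ω hsep hprof,
    openInterDeterminesComponentHolds_of_separating Ω hsep hprof⟩
  -- the sturdy member: `Γ_{5,2}`, `m = 2`, `s = 1` — two once-punctured genus-2 curves glued at two points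
  obtain ⟨Q, ι, G, e, v₀, v₁, n₁, n₂, hι, hS, hi, hn, hr, hC, hV, hN, hV₀, hV₁, hE₁, hE₂, hg₀, hg₁, -⟩ :=
    exists_twoNodeCycleDatum Sigma hne hprime 5 2 2 1 (by norm_num)
  have hne12 : n₁ ≠ n₂ := G.nodes_ne_of_n_eq_two n₁ n₂ hN hn
  refine ⟨Q, G, ?_, fun v => ?_, hS, hi, hn, hr⟩
  · exact ⟨inferInstance, inferInstance, inferInstance, inferInstance, Sigma, 5, 2, 2, 1, by norm_num, ι, e,
      v₀, v₁, n₁, n₂, hne, hprime, hι, by norm_num, le_rfl, le_rfl, hC, hV, hne12, hN, hV₀, hV₁, hE₁, hE₂⟩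
  · rcases hV v with rfl | rfl
    · rw [hg₀]
    · rw [hg₁]


/-- **[CombGC] Prop. 1.2 (i)(ii), [IUTchI] Rmk. 1.2.3 (iv) (F-1931) and Thm. 1.6 (i) (F-0458) at the origin of
two-node-cycle data with `Σ = {l}`**, hypothesis-free, inhabited by the STURDY pro-`l` datum "two
once-punctured genus-`2` curves glued at two points" (`Γ_{5,2}`): F-2830, F-0438, F-0459 as above, F-1931 by
the vertex-free `cuspidalEdgeLikeCharacterizationHolds_of_cuspidallyStandard`, F-0458 by abc-iut-f-164's
reduction `numericallyCuspidalIffHolds_of_characterization`. [cite: MochizukiCombGC2007, Thm 1.6(i) p.13]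
[cite: MochizukiCombGC2007, Prop 1.2 pp.8-9] [cite: Mochizuki2012, IUTchI Rmk 1.2.3(iv) pp.41-42] -/
theorem exists_twoNodeCycleOrigin_thm16i_holds (l : ℕ) (hl : l.Prime) :
    ∃ Ω : PSCOrigin.{0},
      (∃ (Q : ProfiniteGrp.{0}) (G : PSCDatum Q), Ω.IsOfPSCType G ∧ G.IsSturdy ∧ G.Sigma = {l} ∧
        G.graph.i = 2 ∧ G.graph.n = 2 ∧ G.graph.r = 2) ∧
      SeparatingCoveringsHolds Ω ∧ CommensurableTerminalityHolds Ω ∧ OpenInterDeterminesComponentHolds Ω ∧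
      CuspidalEdgeLikeCharacterizationHolds Ω ∧ NumericallyCuspidalIffHolds Ω := by
  classical
  let Ω : PSCOrigin.{0} :=
    ⟨fun {Q} _ _ G => ∃ (_ : IsTopologicalGroup Q), G.Sigma = {l} ∧
      (CompactSpace Q ∧ T2Space Q ∧ TotallyDisconnectedSpace Q ∧
        ∃ (S : Set ℕ) (g r m s : ℕ) (hm : m + 2 ≤ g) (ι : PuncturedSurfaceGroup g r →* Q)
          (e : G.graph.C ≃ Fin r) (v₀ v₁ : G.graph.V) (n₁ n₂ : G.graph.N),
          S.Nonempty ∧ (∀ p ∈ S, p.Prime) ∧ IsProSigmaCompletion S ι ∧ 1 ≤ m ∧ 1 ≤ s ∧ s + 1 ≤ r ∧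
          (∀ c, G.cuspGp c =
            ((PuncturedSurfaceGroup.cuspInertia (g := g) (e c)).map ι).topologicalClosure) ∧
          (∀ w, w = v₀ ∨ w = v₁) ∧ n₁ ≠ n₂ ∧ (∀ n, n = n₁ ∨ n = n₂) ∧
          G.vertGp v₀ = ((Subgroup.closure {x : PuncturedSurfaceGroup g r |
            (∃ i : Fin g, (i : ℕ) < m ∧ (x = PuncturedSurfaceGroup.a i ∨ x = PuncturedSurfaceGroup.b i)) ∨
            (∃ j : Fin r, s ≤ (j : ℕ) ∧ x = PuncturedSurfaceGroup.c j) ∨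
            x = PuncturedSurfaceGroup.a ⟨m, by omega⟩ * PuncturedSurfaceGroup.b ⟨m, by omega⟩ *
              (PuncturedSurfaceGroup.a ⟨m, by omega⟩)⁻¹ ∨
            x = (((List.finRange r).map fun j : Fin r =>
                if (j : ℕ) < s then PuncturedSurfaceGroup.c (g := g) j else 1).prod)⁻¹ *
              (((List.finRange g).map fun i : Fin g => if m + 1 ≤ (i : ℕ) then
                PuncturedSurfaceGroup.a (r := r) i * PuncturedSurfaceGroup.b i *
                  (PuncturedSurfaceGroup.a i)⁻¹ * (PuncturedSurfaceGroup.b i)⁻¹ else 1).prod)⁻¹ *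
              PuncturedSurfaceGroup.b ⟨m, by omega⟩}).map ι).topologicalClosure ∧
          G.vertGp v₁ = ((Subgroup.closure {x : PuncturedSurfaceGroup g r |
            (∃ i : Fin g, m < (i : ℕ) ∧ (x = PuncturedSurfaceGroup.a i ∨ x = PuncturedSurfaceGroup.b i)) ∨
            (∃ j : Fin r, (j : ℕ) < s ∧ x = PuncturedSurfaceGroup.c j) ∨
            x = PuncturedSurfaceGroup.b ⟨m, by omega⟩ ∨
            x = (((List.finRange r).map fun j : Fin r =>
                if (j : ℕ) < s then PuncturedSurfaceGroup.c (g := g) j else 1).prod)⁻¹ *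
              (((List.finRange g).map fun i : Fin g => if m + 1 ≤ (i : ℕ) then
                PuncturedSurfaceGroup.a (r := r) i * PuncturedSurfaceGroup.b i *
                  (PuncturedSurfaceGroup.a i)⁻¹ * (PuncturedSurfaceGroup.b i)⁻¹ else 1).prod)⁻¹ *
              PuncturedSurfaceGroup.b ⟨m, by omega⟩}).map ι).topologicalClosure ∧
          G.nodeGp n₁ = ((Subgroup.zpowers (PuncturedSurfaceGroup.b (r := r) ⟨m, by omega⟩)).map
            ι).topologicalClosure ∧
          G.nodeGp n₂ = ((Subgroup.zpowers ((((List.finRange r).map fun j : Fin r =>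
                if (j : ℕ) < s then PuncturedSurfaceGroup.c (g := g) j else 1).prod)⁻¹ *
              (((List.finRange g).map fun i : Fin g => if m + 1 ≤ (i : ℕ) then
                PuncturedSurfaceGroup.a (r := r) i * PuncturedSurfaceGroup.b i *
                  (PuncturedSurfaceGroup.a i)⁻¹ * (PuncturedSurfaceGroup.b i)⁻¹ else 1).prod)⁻¹ *
              PuncturedSurfaceGroup.b ⟨m, by omega⟩)).map ι).topologicalClosure)⟩
  have hsep : SeparatingCoveringsHolds Ω := by
    intro Q _ _ _ G hG
    obtain ⟨_, -, hc, ht, hd, S, g, r, m, s, hm, ι, e, v₀, v₁, n₁, n₂, hSne, hSp, hι, hm1, hs1, hsr, hC, hV, hn,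
      hN, hV₀, hV₁, hE₁, hE₂⟩ := hG
    haveI := hc
    haveI := hd
    exact G.separatingCoverings_of_twoNodeCycle hSne hSp ι hι hm hm1 hs1 hsr e hC v₀ v₁ hV n₁ n₂ hn hN _ rfl
      hV₀ hV₁ hE₁ hE₂
  have hprof : ∀ ⦃Q : Type⦄ [Group Q] [TopologicalSpace Q] [IsTopologicalGroup Q] (G : PSCDatum Q),
      Ω.IsOfPSCType G → CompactSpace Q ∧ TotallyDisconnectedSpace Q := fun Q _ _ _ G hG => by
    obtain ⟨_, -, hc, -, hd, -⟩ := hG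
    exact ⟨hc, hd⟩
  have hSig : ∀ ⦃Q : Type⦄ [Group Q] [TopologicalSpace Q] [IsTopologicalGroup Q] (G : PSCDatum Q),
      Ω.IsOfPSCType G → G.Sigma = {l} := fun Q _ _ _ G hG => by
    obtain ⟨_, hS, -⟩ := hG
    exact hS
  have hopen : OpenInterDeterminesComponentHolds Ω := openInterDeterminesComponentHolds_of_separating Ω hsep hprof
  have hcusp : CuspidalEdgeLikeCharacterizationHolds Ω :=
    cuspidalEdgeLikeCharacterizationHolds_of_cuspidallyStandard Ω fun Q _ _ _ G hG => by
      obtain ⟨_, -, hc, ht, hd, S, g, r, m, s, hm, ι, e, v₀, v₁, n₁, n₂, hSne, hSp, hι, hm1, hs1, hsr, hC, -⟩ := hG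
      exact ⟨hc, ht, hd, S, g, r, ι, e, hSne, hSp, by unfold PuncturedSurfaceGroup.IsHyperbolicType; omega, hι, hC⟩
  have hl' : ∀ p ∈ ({l} : Set ℕ), p.Prime := fun p hp => by
    rw [Set.mem_singleton_iff.mp hp]; exact hl
  refine ⟨Ω, ?_, hsep, commensurableTerminalityHolds_of_separating Ω hsep hprof, hopen, hcusp,
    numericallyCuspidalIffHolds_of_characterization Ω l hprof hSig hopen hcusp⟩
  obtain ⟨Q, ι, G, e, v₀, v₁, n₁, n₂, hι, hS, hi, hn, hr, hC, hV, hN, hV₀, hV₁, hE₁, hE₂, hg₀, hg₁, -⟩ :=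
    exists_twoNodeCycleDatum {l} ⟨l, rfl⟩ hl' 5 2 2 1 (by norm_num)
  have hne12 : n₁ ≠ n₂ := G.nodes_ne_of_n_eq_two n₁ n₂ hN hn
  refine ⟨Q, G, ?_, fun v => ?_, hS, hi, hn, hr⟩
  · exact ⟨inferInstance, hS, inferInstance, inferInstance, inferInstance, {l}, 5, 2, 2, 1, by norm_num, ι, e,
      v₀, v₁, n₁, n₂, ⟨l, rfl⟩, hl', hι, by norm_num, le_rfl, le_rfl, hC, hV, hne12, hN, hV₀, hV₁, hE₁, hE₂⟩
  · rcases hV v with rfl | rfl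
    · rw [hg₀]
    · rw [hg₁]

end PSCDatum

end Literature.AnabelianGeometry.SemiGraphs

end
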